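import Literature.IUT.HodgeTheaters.DiscreteProfiniteConjugates
import Mathlib.GroupTheory.ResiduallyFinite
import Mathlib.Data.ZMod.Basic
import HarnessLib

/-!
# `ℤ ↪ ℤ̂`: the canonical map from `ℤ` to its profinite completion is injective

[IUTchI] §2 (p. 56: "`F ⊆ F̂` for a residually finite `F`"; Lemma 2.7 (v) p. 57: `ℤ̂`) and the many [IUTchII]/[IUTchIII]
interfaces that carry "the inverse image of `ℤ ⊆ Ẑ`" (e.g. [IUTchII] Rmk. 1.11.5 (i), abc-iut-L6-t1's
`ValuationSurjection.kummer_range`) use that `ℤ → ℤ̂` (the tree's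
`Literature.IUT.HodgeTheaters.toCompletion (Multiplicative ℤ)` into `ZHat`) is INJECTIVE. Classical (ℤ is
residually finite: a nonzero `m` survives in `ℤ/(|m|+1)`); recorded here once, proof-only, for the consumers
(abc-iut cell, NV-L6 wave; seat abc-iut-w5-d114). [cite: Mochizuki2012, I Lem 2.7 (v) p.57]
-/

namespace Literature.IUT.HodgeTheaters

open Function

/-- `ℤ` (written multiplicatively) is residually finite: `m ≠ 0` is detected in `ℤ/(|m|+1)`.
[cite: Mochizuki2012, I Thm 2.6 p.56] -/
theorem residuallyFinite_multiplicative_int : Group.ResiduallyFinite (Multiplicative ℤ) := by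
  refine Group.residuallyFinite_of_forall_exists_finite_monoidHom fun x hx => ?_
  let m : ℤ := Multiplicative.toAdd x
  let N : ℕ := m.natAbs + 1
  haveI : NeZero N := ⟨Nat.succ_ne_zero _⟩
  refine ⟨Multiplicative (ZMod N), inferInstance, inferInstance,
    AddMonoidHom.toMultiplicative (Int.castAddHom (ZMod N)), fun h => hx ?_⟩
  have h1 : ((m : ℤ) : ZMod N) = 0 := congrArg Multiplicative.toAdd h
  rw [ZMod.intCast_zmod_eq_zero_iff_dvd] at h1
  have hm0 : m = 0 := by
    by_contra h0
    have := Nat.le_of_dvd (Int.natAbs_pos.mpr h0) (Int.natCast_dvd.mp h1)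
    omega
  exact Multiplicative.toAdd.injective hm0

/-- **`ℤ ↪ ℤ̂`**: `toCompletion (Multiplicative ℤ) : ℤ → Ẑ` is injective ("`F ⊆ F̂`" for the residually finite
`F = ℤ`). [cite: Mochizuki2012, I Lem 2.7 (v) p.57] -/
theorem toCompletion_int_injective : Injective (toCompletion (Multiplicative ℤ)) := by
  haveI := residuallyFinite_multiplicative_int
  have h := (ProfiniteGrp.ProfiniteCompletion.etaFn_injective_iff_residuallyFinite
    (GrpCat.of (Multiplicative ℤ))).mpr (by assumption)
  exact fun x y hxy => h hxy

/-- Hence two integers with the same image in `ℤ̂` are equal. [cite: Mochizuki2012, I Lem 2.7 (v) p.57] -/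
theorem toCompletion_int_ofAdd_eq_iff (m n : ℤ) :
    toCompletion (Multiplicative ℤ) (Multiplicative.ofAdd m) = toCompletion (Multiplicative ℤ) (Multiplicative.ofAdd n) ↔
      m = n :=
  ⟨fun h => Multiplicative.ofAdd.injective (toCompletion_int_injective h), fun h => by rw [h]⟩

end Literature.IUT.HodgeTheaters
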